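import Summits.CriticalPhenomena.PercolationContinuityZ3.Theorems.SahiAESeparableTiltPrelim
import Summits.CriticalPhenomena.PercolationContinuityZ3.Theorems.SahiAEFourFunctionsDiag

/-!
# The separable tilt — part 2/4: essential down-sets of `ℝ^ι` and Harris' inequality for down-sets

Support file of the Sahi cell (`prim-sahi`): literature seat gen35's kernel file `SahiAESeparableTilt.lean`
(evidence n°8688 on `stmt-CriticalPhenomena-4575`, sha256 `af5f8450…be96`, 1048 lines), landed by a prover seat in FOUR
parts because tree `Theorems/` files are capped at 400 lines: `SahiAESeparableTiltPrelim`, `SahiAESeparableTiltLowerSet`,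
`SahiAESeparableTiltCoord`, `SahiAESeparableTilt` (main theorems).  Every declaration is byte-identical to the evidence
file and keeps its namespace `…Theorems.SahiAESeparableTilt`; only imports, module docstrings and the grouping of the
sections into files differ.  Theorems only (no definitions, no named facts, no sorries).

This part (section `LowerSet` of the evidence file; coordinate `i`, `D(r,s,x) = φ(update x i s) − φ(update x i r)`,
`A(r,s) = ess inf_x D(r,s,x)`):
* `exists_isLowerSet_ae_eq` — an ESSENTIAL down-set of `ℝ^ι` (`x ≤ y`, `y ∈ W ⟹ x ∈ W` for a.e. pair) equals a.e.
  the genuine down-set `{x : λ(W ∩ [x,∞)) > 0}` (Fubini one way, Lebesgue density points the other way: the upper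
  corner `[x, x+r]` is a `2^{-|ι|}`-th of the sup-norm ball).
* `volume_inter_ne_zero_of_isLowerSet` — Harris' inequality for down-sets of positive measure in a box, from the
  everywhere four functions theorem `Literature.Probability.LatticeModels.lintegral_four_functions`
  ([KarlinRinott1980, Thm. 2.1]).
* `essInf_add_ge` / `essInf_add_le_of_ae_monotone` — `A` is super-additive on all triples and SUB-additive on triples
  whose links are good (the near-infimum sets `{D < A + δ}` are essential down-sets of positive measure).

Imports part 1 (`SahiAESeparableTiltPrelim`); used by parts 3–4 (`SahiAESeparableTiltCoord`, `SahiAESeparableTilt`).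
No sorries, no new axioms (`#print axioms`: propext, Classical.choice, Quot.sound).
-/

noncomputable section

namespace Summit.CriticalPhenomena.PercolationContinuityZ3.Theorems.SahiAESeparableTilt

open MeasureTheory Set Filter Topology Metric Function
open Summit.CriticalPhenomena.PercolationContinuityZ3.Theorems.SahiAEFourFunctions
open scoped ENNReal NNReal

variable {ι : Type*} [Fintype ι]

/-! ### Essential down-sets of `ℝ^ι` are down-sets almost everywhere; Harris for down-sets -/

section LowerSet

/-- The order relation of `ℝ^ι` is a measurable subset of `ℝ^ι × ℝ^ι`. [folklore] -/
theorem measurableSet_le_pi : MeasurableSet {q : (ι → ℝ) × (ι → ℝ) | q.1 ≤ q.2} := by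
  have e : {q : (ι → ℝ) × (ι → ℝ) | q.1 ≤ q.2} = ⋂ i, {q | q.1 i ≤ q.2 i} := by
    ext q
    simp only [mem_setOf_eq, mem_iInter]
    exact Iff.rfl
  rw [e]
  exact MeasurableSet.iInter fun i =>
    measurableSet_le ((measurable_pi_apply i).comp measurable_fst) ((measurable_pi_apply i).comp measurable_snd)

/-- Measurability of `x ↦ λ(W ∩ [x, ∞))`. [folklore] -/
theorem measurable_volume_inter_Ici {W : Set (ι → ℝ)} (hW : MeasurableSet W) :
    Measurable fun x : ι → ℝ => volume (W ∩ Ici x) := by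
  have hT : MeasurableSet {q : (ι → ℝ) × (ι → ℝ) | q.2 ∈ W ∧ q.1 ≤ q.2} :=
    (measurable_snd hW).inter measurableSet_le_pi
  have hm := measurable_measure_prodMk_left (ν := (volume : Measure (ι → ℝ))) hT
  have e : (fun x : ι → ℝ => volume (W ∩ Ici x)) =
      fun x => volume (Prod.mk x ⁻¹' {q : (ι → ℝ) × (ι → ℝ) | q.2 ∈ W ∧ q.1 ≤ q.2}) := by
    funext x
    rfl
  rw [e]
  exact hm

/-- **An essential down-set of `ℝ^ι` is a down-set up to a Lebesgue-null set.**  If `W` is measurable and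
`x ≤ y, y ∈ W ⟹ x ∈ W` for `λ ⊗ λ`-almost every `(x, y)`, then `W' = {x : λ(W ∩ [x,∞)) > 0}` is a measurable GENUINE
down-set with `λ(W' ∆ W) = 0`: `W' ∖ W` is null by Fubini, `W ∖ W'` is null at every Lebesgue density point of `W`
(the upper corner `[x, x + r]` is a `2^{-|ι|}`-th of the sup-norm ball `B̄(x, r)`). [this work] -/
theorem exists_isLowerSet_ae_eq {W : Set (ι → ℝ)} (hW : MeasurableSet W)
    (h : ∀ᵐ p ∂(volume : Measure (ι → ℝ)).prod volume, p.1 ≤ p.2 → p.2 ∈ W → p.1 ∈ W) :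
    ∃ W' : Set (ι → ℝ), MeasurableSet W' ∧ IsLowerSet W' ∧ volume (W' \ W) = 0 ∧ volume (W \ W') = 0 := by
  have hmeas := measurable_volume_inter_Ici hW
  refine ⟨{x | volume (W ∩ Ici x) ≠ 0}, hmeas (measurableSet_singleton 0).compl, ?_, ?_, ?_⟩
  · intro x y hyx hx h0
    exact hx (measure_mono_null (inter_subset_inter_right W (Ici_subset_Ici.2 hyx)) h0)
  · -- `W' ∖ W` is null: Fubini
    have h' : ∀ᵐ x ∂(volume : Measure (ι → ℝ)), ∀ᵐ y ∂(volume : Measure (ι → ℝ)), x ≤ y → y ∈ W → x ∈ W :=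
      Measure.ae_ae_of_ae_prod (p := fun p : (ι → ℝ) × (ι → ℝ) => p.1 ≤ p.2 → p.2 ∈ W → p.1 ∈ W) h
    refine measure_mono_null (fun x hx => ?_) (ae_iff.1 h')
    intro hQ
    obtain ⟨hx1, hx2⟩ := hx
    apply hx1
    have hn : ∀ᵐ y ∂(volume : Measure (ι → ℝ)), y ∉ W ∩ Ici x := by
      filter_upwards [hQ] with y hy hyW
      exact hx2 (hy hyW.2 hyW.1)
    exact measure_eq_zero_iff_ae_notMem.2 hn
  · -- `W ∖ W'` is null: Lebesgue density
    have hd := Besicovitch.ae_tendsto_measure_inter_div_of_measurableSet (volume : Measure (ι → ℝ)) hW.compl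
    refine measure_mono_null (fun x hx => ?_) (ae_iff.1 hd)
    intro hT
    obtain ⟨hxW, hx0⟩ := hx
    have hx0' : volume (W ∩ Ici x) = 0 := by
      by_contra hne
      exact hx0 hne
    have h0 : (Wᶜ).indicator (1 : (ι → ℝ) → ℝ≥0∞) x = 0 := Set.indicator_of_notMem (Set.notMem_compl_iff.2 hxW) _
    rw [h0] at hT
    have hsmall : ∀ᶠ ρ in 𝓝[>] (0 : ℝ),
        volume (Wᶜ ∩ closedBall x ρ) / volume (closedBall x ρ) < ((2 : ℝ≥0∞) ^ Fintype.card ι)⁻¹ :=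
      (tendsto_order.1 hT).2 _ (ENNReal.inv_pos.2 (ENNReal.pow_ne_top ENNReal.ofNat_ne_top))
    obtain ⟨r, hr, hrpos⟩ := (hsmall.and eventually_mem_nhdsWithin).exists
    change 0 < r at hrpos
    -- the upper corner `U = ∏ [x i, x i + r]`
    set U : Set (ι → ℝ) := Set.pi univ fun i => Icc (x i) (x i + r) with hUdef
    have hU : volume U = ENNReal.ofReal r ^ Fintype.card ι := by
      rw [hUdef, volume_pi_pi]
      simp only [Real.volume_Icc, add_sub_cancel_left, Finset.prod_const, Finset.card_univ]
    have hBall : volume (closedBall x r) = 2 ^ Fintype.card ι * ENNReal.ofReal r ^ Fintype.card ι :=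
      volume_closedBall_eq_pow_mul x hrpos.le
    have hR0 : ENNReal.ofReal r ^ Fintype.card ι ≠ 0 := pow_ne_zero _ (ENNReal.ofReal_pos.2 hrpos).ne'
    have hRT : ENNReal.ofReal r ^ Fintype.card ι ≠ ∞ := ENNReal.pow_ne_top ENNReal.ofReal_ne_top
    have h2T : (2 : ℝ≥0∞) ^ Fintype.card ι ≠ ∞ := ENNReal.pow_ne_top ENNReal.ofNat_ne_top
    have h20 : (2 : ℝ≥0∞) ^ Fintype.card ι ≠ 0 := pow_ne_zero _ two_ne_zero
    have hB0 : volume (closedBall x r) ≠ 0 := by rw [hBall]; exact mul_ne_zero h20 hR0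
    have hBT : volume (closedBall x r) ≠ ∞ := by rw [hBall]; exact ENNReal.mul_ne_top h2T hRT
    have hlt : volume (Wᶜ ∩ closedBall x r) < volume U := by
      have h1 := (ENNReal.div_lt_iff (Or.inl hB0) (Or.inl hBT)).1 hr
      rw [hBall, ← mul_assoc, ENNReal.inv_mul_cancel h20 h2T, one_mul, ← hU] at h1
      exact h1
    have hUB : U ⊆ closedBall x r := by
      intro y hy
      rw [closedBall_pi x hrpos.le, Set.mem_univ_pi]
      rw [hUdef, Set.mem_univ_pi] at hy
      intro i
      rw [Real.closedBall_eq_Icc]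
      exact ⟨by linarith [(hy i).1], (hy i).2⟩
    have hUx : ∀ y ∈ U, x ≤ y := fun y hy i => by
      rw [hUdef, Set.mem_univ_pi] at hy
      exact (hy i).1
    have hsub : U ⊆ (Wᶜ ∩ closedBall x r) ∪ (W ∩ Ici x) := by
      intro y hy
      by_cases hyW : y ∈ W
      · exact Or.inr ⟨hyW, hUx y hy⟩
      · exact Or.inl ⟨hyW, hUB hy⟩
    have hle : volume U ≤ volume (Wᶜ ∩ closedBall x r) + volume (W ∩ Ici x) :=
      (measure_mono hsub).trans (measure_union_le _ _)
    rw [hx0', add_zero] at hle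
    exact (lt_irrefl _) (hlt.trans_le hle)

/-- A sup-norm ball about `0` is a sublattice of `ℝ^ι`. [folklore] -/
theorem sup_mem_closedBall_zero {x y : ι → ℝ} {R : ℝ} (hx : x ∈ closedBall (0 : ι → ℝ) R)
    (hy : y ∈ closedBall (0 : ι → ℝ) R) : x ⊔ y ∈ closedBall (0 : ι → ℝ) R := by
  rcases lt_or_ge R 0 with hR | hR
  · exact absurd hx (by rw [closedBall_eq_empty.2 hR]; exact notMem_empty _)
  rw [closedBall_pi _ hR, Set.mem_univ_pi] at hx hy ⊢
  intro i
  have hxi := hx i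
  have hyi := hy i
  rw [Pi.zero_apply, Real.closedBall_eq_Icc, zero_sub, zero_add] at hxi hyi ⊢
  exact ⟨le_sup_of_le_left hxi.1, sup_le hxi.2 hyi.2⟩

/-- A sup-norm ball about `0` is a sublattice of `ℝ^ι`. [folklore] -/
theorem inf_mem_closedBall_zero {x y : ι → ℝ} {R : ℝ} (hx : x ∈ closedBall (0 : ι → ℝ) R)
    (hy : y ∈ closedBall (0 : ι → ℝ) R) : x ⊓ y ∈ closedBall (0 : ι → ℝ) R := by
  rcases lt_or_ge R 0 with hR | hR
  · exact absurd hx (by rw [closedBall_eq_empty.2 hR]; exact notMem_empty _)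
  rw [closedBall_pi _ hR, Set.mem_univ_pi] at hx hy ⊢
  intro i
  have hxi := hx i
  have hyi := hy i
  rw [Pi.zero_apply, Real.closedBall_eq_Icc, zero_sub, zero_add] at hxi hyi ⊢
  exact ⟨le_inf hxi.1 hyi.1, inf_le_of_left_le hxi.2⟩

/-- A set of positive Lebesgue measure meets some ball about `0` in positive measure. [folklore] -/
theorem exists_volume_inter_closedBall_ne_zero {W : Set (ι → ℝ)} (hW : volume W ≠ 0) :
    ∃ n : ℕ, volume (W ∩ closedBall (0 : ι → ℝ) n) ≠ 0 := by
  by_contra hall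
  push Not at hall
  apply hW
  have e : W = ⋃ n : ℕ, W ∩ closedBall (0 : ι → ℝ) n := by
    rw [← inter_iUnion, iUnion_closedBall_nat, inter_univ]
  rw [e]
  exact measure_iUnion_null hall

/-- **Harris' inequality for down-sets of `ℝ^ι`, positivity form**: two measurable down-sets of positive Lebesgue
measure meet in a set of positive measure (the everywhere four functions theorem on a large ball,
`Literature.Probability.LatticeModels.lintegral_four_functions`, with `1_{W₁∩Q}, 1_{W₂∩Q}, 1_Q, 1_{W₁∩W₂∩Q}`).
[cite: KarlinRinott1980, Thm. 2.1] -/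
theorem volume_inter_ne_zero_of_isLowerSet {W₁ W₂ : Set (ι → ℝ)} (m₁ : MeasurableSet W₁) (m₂ : MeasurableSet W₂)
    (l₁ : IsLowerSet W₁) (l₂ : IsLowerSet W₂) (p₁ : volume W₁ ≠ 0) (p₂ : volume W₂ ≠ 0) :
    volume (W₁ ∩ W₂) ≠ 0 := by
  obtain ⟨n₁, hn₁⟩ := exists_volume_inter_closedBall_ne_zero p₁
  obtain ⟨n₂, hn₂⟩ := exists_volume_inter_closedBall_ne_zero p₂
  set Q : Set (ι → ℝ) := closedBall (0 : ι → ℝ) (max n₁ n₂ : ℕ) with hQ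
  have mQ : MeasurableSet Q := measurableSet_closedBall
  have hQ₁ : volume (W₁ ∩ Q) ≠ 0 := fun h0 => hn₁ (measure_mono_null
    (inter_subset_inter_right _ (closedBall_subset_closedBall (by exact_mod_cast le_max_left n₁ n₂))) h0)
  have hQ₂ : volume (W₂ ∩ Q) ≠ 0 := fun h0 => hn₂ (measure_mono_null
    (inter_subset_inter_right _ (closedBall_subset_closedBall (by exact_mod_cast le_max_right n₁ n₂))) h0)
  have key := Literature.Probability.LatticeModels.lintegral_four_functions (fun _ : ι => (volume : Measure ℝ))
    ((W₁ ∩ Q).indicator 1) ((W₂ ∩ Q).indicator 1) (Q.indicator 1) ((W₁ ∩ W₂ ∩ Q).indicator 1)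
    (measurable_one.indicator (m₁.inter mQ)) (measurable_one.indicator (m₂.inter mQ))
    (measurable_one.indicator mQ) (measurable_one.indicator ((m₁.inter m₂).inter mQ)) (fun x y => by
      by_cases hx : x ∈ W₁ ∩ Q
      · by_cases hy : y ∈ W₂ ∩ Q
        · have h3 : x ⊔ y ∈ Q := sup_mem_closedBall_zero hx.2 hy.2
          have h4 : x ⊓ y ∈ W₁ ∩ W₂ ∩ Q :=
            ⟨⟨l₁ inf_le_left hx.1, l₂ inf_le_right hy.1⟩, inf_mem_closedBall_zero hx.2 hy.2⟩
          rw [Set.indicator_of_mem hx, Set.indicator_of_mem hy, Set.indicator_of_mem h3, Set.indicator_of_mem h4]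
          simp only [Pi.one_apply, mul_one, le_refl]
        · rw [Set.indicator_of_notMem hy, mul_zero]
          exact zero_le
      · rw [Set.indicator_of_notMem hx, zero_mul]
        exact zero_le)
  rw [← volume_pi, lintegral_indicator_one (m₁.inter mQ), lintegral_indicator_one (m₂.inter mQ),
    lintegral_indicator_one mQ, lintegral_indicator_one ((m₁.inter m₂).inter mQ)] at key
  intro h0
  have h0' : volume (W₁ ∩ W₂ ∩ Q) = 0 := measure_mono_null inter_subset_left h0
  rw [h0', mul_zero, nonpos_iff_eq_zero, mul_eq_zero] at key
  exact key.elim hQ₁ hQ₂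

/-- **Sub-additivity of the essential infimum for a.e.-monotone functions (Lebesgue).**  If `u, v : ℝ^ι → ℝ` are
bounded, measurable and non-decreasing on `λ ⊗ λ`-almost every comparable pair, then
`ess inf (u + v) ≤ ess inf u + ess inf v`: the near-infimum sets `{u < ess inf u + δ}`, `{v < ess inf v + δ}` are
essential down-sets of positive measure, hence (`exists_isLowerSet_ae_eq`) a.e. equal to genuine down-sets, which
meet in positive measure by Harris. [this work] -/
theorem essInf_add_le_of_ae_monotone {u v : (ι → ℝ) → ℝ} (hu : Measurable u) (hv : Measurable v) {B : ℝ}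
    (huB : ∀ x, |u x| ≤ B) (hvB : ∀ x, |v x| ≤ B)
    (mu : ∀ᵐ p ∂(volume : Measure (ι → ℝ)).prod volume, p.1 ≤ p.2 → u p.1 ≤ u p.2)
    (mv : ∀ᵐ p ∂(volume : Measure (ι → ℝ)).prod volume, p.1 ≤ p.2 → v p.1 ≤ v p.2) :
    essInf (fun x => u x + v x) volume ≤ essInf u volume + essInf v volume := by
  have hvol : (volume : Measure (ι → ℝ)) ≠ 0 := volume_pi_ne_zero
  have hulo : ∀ x, -B ≤ u x := fun x => (abs_le.1 (huB x)).1
  have huhi : ∀ x, u x ≤ B := fun x => (abs_le.1 (huB x)).2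
  have hvlo : ∀ x, -B ≤ v x := fun x => (abs_le.1 (hvB x)).1
  have hvhi : ∀ x, v x ≤ B := fun x => (abs_le.1 (hvB x)).2
  refine le_of_forall_pos_le_add fun ε hε => ?_
  set δ := ε / 2 with hδ
  have hδpos : 0 < δ := by positivity
  -- the near-infimum sets
  set W₁ := {x : ι → ℝ | u x < essInf u volume + δ} with hW₁
  set W₂ := {x : ι → ℝ | v x < essInf v volume + δ} with hW₂
  have mW₁ : MeasurableSet W₁ := measurableSet_lt hu measurable_const
  have mW₂ : MeasurableSet W₂ := measurableSet_lt hv measurable_const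
  have pW₁ : volume W₁ ≠ 0 := measure_ne_zero_of_essInf_lt huhi hvol (by linarith)
  have pW₂ : volume W₂ ≠ 0 := measure_ne_zero_of_essInf_lt hvhi hvol (by linarith)
  have eW₁ : ∀ᵐ p ∂(volume : Measure (ι → ℝ)).prod volume, p.1 ≤ p.2 → p.2 ∈ W₁ → p.1 ∈ W₁ := by
    filter_upwards [mu] with p hp hle h2
    exact lt_of_le_of_lt (hp hle) h2
  have eW₂ : ∀ᵐ p ∂(volume : Measure (ι → ℝ)).prod volume, p.1 ≤ p.2 → p.2 ∈ W₂ → p.1 ∈ W₂ := by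
    filter_upwards [mv] with p hp hle h2
    exact lt_of_le_of_lt (hp hle) h2
  obtain ⟨W₁', mW₁', lW₁', d₁, d₁'⟩ := exists_isLowerSet_ae_eq mW₁ eW₁
  obtain ⟨W₂', mW₂', lW₂', d₂, d₂'⟩ := exists_isLowerSet_ae_eq mW₂ eW₂
  have pW₁' : volume W₁' ≠ 0 := by
    intro h0
    apply pW₁
    have hsub : W₁ ⊆ (W₁ \ W₁') ∪ W₁' := fun x hx => by
      by_cases h : x ∈ W₁'
      · exact Or.inr h
      · exact Or.inl ⟨hx, h⟩
    exact measure_mono_null hsub (measure_union_null d₁' h0)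
  have pW₂' : volume W₂' ≠ 0 := by
    intro h0
    apply pW₂
    have hsub : W₂ ⊆ (W₂ \ W₂') ∪ W₂' := fun x hx => by
      by_cases h : x ∈ W₂'
      · exact Or.inr h
      · exact Or.inl ⟨hx, h⟩
    exact measure_mono_null hsub (measure_union_null d₂' h0)
  have hH := volume_inter_ne_zero_of_isLowerSet mW₁' mW₂' lW₁' lW₂' pW₁' pW₂'
  have hW : volume (W₁ ∩ W₂) ≠ 0 := by
    intro h0
    apply hH
    have hsub : W₁' ∩ W₂' ⊆ (W₁ ∩ W₂) ∪ ((W₁' \ W₁) ∪ (W₂' \ W₂)) := fun x hx => by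
      by_cases h1 : x ∈ W₁
      · by_cases h2 : x ∈ W₂
        · exact Or.inl ⟨h1, h2⟩
        · exact Or.inr (Or.inr ⟨hx.2, h2⟩)
      · exact Or.inr (Or.inl ⟨hx.1, h1⟩)
    exact measure_mono_null hsub (measure_union_null h0 (measure_union_null d₁ d₂))
  have hsub : W₁ ∩ W₂ ⊆ {x | u x + v x < essInf u volume + essInf v volume + ε} := fun x hx => by
    have h1 : u x < essInf u volume + δ := hx.1
    have h2 : v x < essInf v volume + δ := hx.2
    show u x + v x < essInf u volume + essInf v volume + ε
    linarith
  have hne : volume {x | u x + v x < essInf u volume + essInf v volume + ε} ≠ 0 :=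
    fun h0 => hW (measure_mono_null hsub h0)
  exact essInf_le_of_measure_ne_zero (lo := -B + -B) (fun x => add_le_add (hulo x) (hvlo x)) hne

/-- **Super-additivity of the essential infimum** (any measure): `ess inf u + ess inf v ≤ ess inf (u + v)` for
bounded `u, v`. [folklore] -/
theorem essInf_add_ge {α : Type*} [MeasurableSpace α] {μ : Measure α} (hμ : μ ≠ 0) {u v : α → ℝ} {B : ℝ}
    (huB : ∀ x, |u x| ≤ B) (hvB : ∀ x, |v x| ≤ B) :
    essInf u μ + essInf v μ ≤ essInf (fun x => u x + v x) μ := by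
  have hulo : ∀ x, -B ≤ u x := fun x => (abs_le.1 (huB x)).1
  have hvlo : ∀ x, -B ≤ v x := fun x => (abs_le.1 (hvB x)).1
  have huhi : ∀ x, u x ≤ B := fun x => (abs_le.1 (huB x)).2
  have hvhi : ∀ x, v x ≤ B := fun x => (abs_le.1 (hvB x)).2
  have h1 : ∀ᵐ x ∂μ, essInf u μ ≤ u x := ae_essInf_le_of_forall_le hulo
  have h2 : ∀ᵐ x ∂μ, essInf v μ ≤ v x := ae_essInf_le_of_forall_le hvlo
  have h12 : ∀ᵐ x ∂μ, essInf u μ + essInf v μ ≤ u x + v x := by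
    filter_upwards [h1, h2] with x a b using add_le_add a b
  by_contra hlt
  push Not at hlt
  have hne := measure_ne_zero_of_essInf_lt (f := fun x => u x + v x) (fun x => add_le_add (huhi x) (hvhi x)) hμ hlt
  apply hne
  rw [← ae_iff.1 h12]
  congr 1
  ext x
  simp only [mem_setOf_eq, not_le]

end LowerSet

end Summit.CriticalPhenomena.PercolationContinuityZ3.Theorems.SahiAESeparableTilt

end
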